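import Summits.RiemannHypothesis.RiemannHypothesis.Theses.WeilComb
import Mathlib.Analysis.SpecialFunctions.Log.Basic
import Mathlib.Analysis.SpecialFunctions.Exp
import Mathlib.Analysis.Complex.ExponentialBounds
import Mathlib.Analysis.Real.Pi.Bounds

/-!
# Stub `stub_assemble40` of line `Sketch` for crux `WeilComb.CombShapePositivity`
(item stmt-RiemannHypothesis-11229, route route-RiemannHypothesis-WeilComb)

The pure real-arithmetic budget of the effective subcritical window `εM ≤ 1/40` for the fixed-shape comb
(skeleton v7, `Cruxes/CombShapePositivity/Lines/Sketch.lean`, theorem `stub_windowSub40`). All analysis is in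
the four landed stubs `stub_offdiagSchur` (p109602), `stub_poincareEta` (p109896), `stub_archBathtub` (p110455),
`stub_helsonG` (p110888); here only real numbers occur.

Notation (all real variables): `ε` the width, `Mr = M`, `λ = εMr ≤ 1/40`; `N = ‖φ₀‖₂²`, `I = ∫φ₀` (`I² ≤ 2N`);
`L = Σ‖a_m‖²`, `D` the Dirichlet energy, `Qp = Σ m log m ‖a_m‖²`, `Q1 = Σ m‖a_m‖²`, `V` the Helson potential,
`H = V − D` the Helson form, `ReQ = Re Q(g)`, `ReP` the polar term, `Wd = Re W_∞(ψ_ε)` (diagonal archimedean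
symbol), `Off` the off-diagonal archimedean form, `F0, F1 = |φ̂_ε(0)|, |φ̂_ε(1)|`, `nAm, nAp = ‖A₋‖, ‖A₊‖`.

**Budget** (per unit `ε⁻¹N`, with `E = e^ε ≤ 1.0257`, `κ = (1 − (e^{4ε}−1)Mr/2)⁻¹ ≤ 1.0583`, `A = 1 + log Mr`,
`X = εAQ1 ≤ εQp + λL ≤ 11λD + 2.265λL` by the Poincaré inequality at `η = 10`):
`ReQ/(ε⁻¹N) ≥ D[1 − (E + 2Eκ)·11λ] + L[log 10 − 1.78 − 4Eλ − (E + 2Eκ)·2.265λ − (42/(5π))ε] ≥ 0.12 D + 0.16 L ≥ 0`,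
using the diagonal `log(ε⁻¹N/(2I²)) ≥ log(1/ε) − log 4 ≥ log Mr + log 40 − log 4`, the Helson constant `39/50`,
the pole `2‖A₋‖‖A₊‖ ≤ 2MrL + AQ1/2` (AM–GM on `‖A₋‖² ≤ AL`, `‖A₊‖² ≤ MrQ1`) with `F0F1 ≤ e^ε I²`, and `I² ≤ 2N`
in every negative term.
-/

noncomputable section

-- the sub-problem path `RiemannHypothesis/RiemannHypothesis` (single-conjunct summit, D-0017) duplicates a namespace
set_option linter.dupNamespace false

namespace Summit.RiemannHypothesis.RiemannHypothesis.Theorems.WeilCombBohrFejer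

/-- `log 10 ≥ 2.3022` (from `2^93 ≤ 10^28` and `log 2 > 0.6931471803`). [folklore] -/
private theorem log_ten_ge_assemble40 : (2.3022 : ℝ) ≤ Real.log 10 := by
  have h2 := Real.log_two_gt_d9
  have hpow : ((2 : ℝ)) ^ 93 ≤ (10 : ℝ) ^ 28 := by norm_num
  have hlog : Real.log ((2 : ℝ) ^ 93) ≤ Real.log ((10 : ℝ) ^ 28) :=
    Real.log_le_log (by positivity) hpow
  rw [Real.log_pow, Real.log_pow] at hlog
  push_cast at hlog
  linarith

/-- `e^x ≤ 1 + x + x²` for `0 ≤ x ≤ 1`. [folklore] -/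
private theorem exp_le_quad_assemble40 {x : ℝ} (hx0 : 0 ≤ x) (hx1 : x ≤ 1) :
    Real.exp x ≤ 1 + x + x ^ 2 := by
  have h0 : |x| ≤ 1 := by rw [abs_of_nonneg hx0]; exact hx1
  have h' := (abs_le.1 (Real.abs_exp_sub_one_sub_id_le h0)).2
  linarith

/-- **Stub S5 — the budget of the effective window `εM ≤ 1/40` (pure real arithmetic).**
Per unit `ε⁻¹N`: diagonal `log(1/ε) − 1 − log(2I²/N) ≥ log M + log 40 − 1 − log 4`, Helson `−(log M + 39/50)`,
pole `≤ e^{ε}(I²/N)(2λL + X/2)`, off-diagonal `≤ (I²/N)e^{ε}(1 − (e^{4ε}−1)M/2)⁻¹ X` with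
`X = ε(1 + log M)Q₁ ≤ εQ' + λL ≤ (1+η)λD + ((1+1/η)(23/20) + 1)λL` (`η = 10`, `λ = εM ≤ 1/40`):
`log 40 = 3.689 > 1 + log 4 + 39/50 + 11.3/40 + O(ε)`. -/
theorem stub_assemble40 : ∀ {ε Mr N I L D Qp Q1 V H ReQ ReP Wd Off F0 F1 nAm nAp : ℝ},
    0 < ε → 1 ≤ Mr → ε * Mr ≤ 1 / 40 →
    0 < N → 0 < I → I ^ 2 ≤ 2 * N →
    0 ≤ L → 0 ≤ D → 0 ≤ Qp → 0 ≤ Q1 →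
    (Real.log Mr + 1) * Q1 ≤ Qp + Mr * L →
    (∀ η : ℝ, 0 < η → Qp ≤ (1 + η) * Mr * D + (1 + 1 / η) * (23 / 20) * Mr * L) →
    V ≤ (Real.log Mr + 39 / 50) * L → H = V - D →
    ReQ = ReP - ε⁻¹ * N * H + (L * Wd + Off) →
    0 ≤ F0 → 0 ≤ F1 → F0 ≤ Real.exp (ε / 2) * I → F1 ≤ Real.exp (ε / 2) * I →
    0 ≤ nAm → 0 ≤ nAp → nAm ^ 2 ≤ (1 + Real.log Mr) * L → nAp ^ 2 ≤ Mr * Q1 →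
    -(2 * (F0 * F1 * (nAm * nAp))) ≤ ReP →
    ε⁻¹ * N * (Real.log (ε⁻¹ * N / (2 * I ^ 2)) - 1) - 21 / (5 * Real.pi) * I ^ 2 ≤ Wd →
    -(I ^ 2 * Real.exp ε * (1 - (Real.exp (4 * ε) - 1) * Mr / 2)⁻¹ * (1 + Real.log Mr) * Q1) ≤ Off →
    0 ≤ ReQ := by
  intro ε Mr N I L D Qp Q1 V H ReQ ReP Wd Off F0 F1 nAm nAp hε hM hlam hN hI hI2 hL hD hQp hQ1 hQ1le hPoinc
    hV hH hQ hF0 hF1 hF0le hF1le hnAm hnAp hnAm2 hnAp2 hP hWd hOff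
  -- elementary constants
  have hl2lo := Real.log_two_gt_d9
  have hl2hi := Real.log_two_lt_d9
  have hlog4 : Real.log 4 = 2 * Real.log 2 := by
    rw [show (4 : ℝ) = 2 ^ 2 by norm_num, Real.log_pow]; norm_num
  have hlog40 : Real.log 40 = Real.log 4 + Real.log 10 := by
    rw [show (40 : ℝ) = 4 * 10 by norm_num, Real.log_mul (by norm_num) (by norm_num)]
  have hlog10 := log_ten_ge_assemble40
  have hπ3 : (3 : ℝ) < Real.pi := Real.pi_gt_three
  have hMr0 : 0 < Mr := by linarith only [hM]
  have hε40 : ε ≤ 1 / 40 := by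
    have : ε * 1 ≤ ε * Mr := mul_le_mul_of_nonneg_left hM hε.le
    linarith only [this, hlam]
  have hlam0 : 0 ≤ ε * Mr := by positivity
  -- `E = e^ε`
  set E : ℝ := Real.exp ε with hE
  have hEpos : 0 < E := Real.exp_pos ε
  have hEle : E ≤ 1.0257 := by
    have h := exp_le_quad_assemble40 hε.le (by linarith only [hε40])
    have hε2 : ε ^ 2 ≤ (1 / 40) ^ 2 := pow_le_pow_left₀ hε.le hε40 2
    rw [hE]
    linarith only [h, hε2, hε40, hε]
  -- `t = (e^{4ε} − 1) Mr / 2 ∈ [0, 0.055]`, `κ = (1 − t)⁻¹ ∈ (0, 1.0583]`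
  set t : ℝ := (Real.exp (4 * ε) - 1) * Mr / 2 with ht
  have ht0 : 0 ≤ t := by
    have : 1 ≤ Real.exp (4 * ε) := Real.one_le_exp (by positivity)
    rw [ht]
    have : 0 ≤ (Real.exp (4 * ε) - 1) * Mr := mul_nonneg (by linarith only [this]) hMr0.le
    linarith only [this]
  have htle : t ≤ 0.055 := by
    have h := exp_le_quad_assemble40 (x := 4 * ε) (by positivity) (by linarith only [hε40])
    have h1 : (Real.exp (4 * ε) - 1) * Mr ≤ (4 * ε + (4 * ε) ^ 2) * Mr :=
      mul_le_mul_of_nonneg_right (by linarith only [h]) hMr0.le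
    have h2 : (4 * ε + (4 * ε) ^ 2) * Mr = 4 * (ε * Mr) + 16 * ε * (ε * Mr) := by ring
    have h3 : 16 * ε * (ε * Mr) ≤ 16 * (1 / 40) * (1 / 40) := by
      have := mul_le_mul hε40 hlam (by positivity) (by norm_num : (0 : ℝ) ≤ 1 / 40)
      linarith only [this]
    rw [ht]
    linarith only [h1, h2, h3, hlam]
  set κ : ℝ := (1 - t)⁻¹ with hκ
  have h1t : 0.945 ≤ 1 - t := by linarith only [htle]
  have hκpos : 0 < κ := by rw [hκ]; exact inv_pos.2 (by linarith only [h1t])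
  have hκle : κ ≤ 1.0583 := by
    rw [hκ, inv_le_comm₀ (by linarith only [h1t]) (by norm_num)]
    linarith only [h1t]
  have hκexpr : (1 - (Real.exp (4 * ε) - 1) * Mr / 2)⁻¹ = κ := by rw [hκ, ht]
  -- `A = 1 + log Mr ≥ 1`
  set A : ℝ := 1 + Real.log Mr with hA
  have hlogMr : 0 ≤ Real.log Mr := Real.log_nonneg hM
  have hA1 : 1 ≤ A := by rw [hA]; linarith only [hlogMr]
  have hA0 : 0 < A := by linarith only [hA1]
  -- `X = ε A Q1 ≤ 11 λ D + 2.265 λ L`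
  set X : ℝ := ε * A * Q1 with hX
  have hX0 : 0 ≤ X := by positivity
  have hXle : X ≤ 11 * (ε * Mr) * D + 2.265 * (ε * Mr) * L := by
    have hP10 := hPoinc 10 (by norm_num)
    have h1 : A * Q1 ≤ Qp + Mr * L := by rw [hA, add_comm]; exact hQ1le
    have h2 : ε * (A * Q1) ≤ ε * (Qp + Mr * L) := mul_le_mul_of_nonneg_left h1 hε.le
    have h3 : ε * Qp ≤ ε * ((1 + 10) * Mr * D + (1 + 1 / 10) * (23 / 20) * Mr * L) :=
      mul_le_mul_of_nonneg_left hP10 hε.le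
    have e3 : ε * ((1 + 10) * Mr * D + (1 + 1 / 10) * (23 / 20) * Mr * L) =
        11 * (ε * Mr) * D + 1.265 * (ε * Mr) * L := by ring
    rw [hX]
    have e2 : ε * A * Q1 = ε * (A * Q1) := by ring
    rw [e2]
    have e4 : ε * (Qp + Mr * L) = ε * Qp + (ε * Mr) * L := by ring
    linarith only [h2, h3, e3, e4]
  -- the pole: `2 nAm nAp ≤ 2 Mr L + A Q1 / 2` and `F0 F1 ≤ E I²`
  have hpole : 2 * (nAm * nAp) ≤ 2 * Mr * L + A * Q1 / 2 := by
    have hsq : 0 ≤ (2 * Mr * nAm - A * nAp) ^ 2 := sq_nonneg _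
    have esq : (2 * Mr * nAm - A * nAp) ^ 2 =
        4 * Mr ^ 2 * nAm ^ 2 - 4 * Mr * A * (nAm * nAp) + A ^ 2 * nAp ^ 2 := by ring
    have hk : 4 * Mr * A * (nAm * nAp) ≤ 4 * Mr ^ 2 * nAm ^ 2 + A ^ 2 * nAp ^ 2 := by
      rw [esq] at hsq; linarith only [hsq]
    have hk1 : 4 * Mr ^ 2 * nAm ^ 2 ≤ 4 * Mr ^ 2 * (A * L) := by
      rw [hA]; exact mul_le_mul_of_nonneg_left hnAm2 (by positivity)
    have hk2 : A ^ 2 * nAp ^ 2 ≤ A ^ 2 * (Mr * Q1) := mul_le_mul_of_nonneg_left hnAp2 (by positivity)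
    have e3 : (Mr * A) * (4 * Mr * L + A * Q1) = 4 * Mr ^ 2 * (A * L) + A ^ 2 * (Mr * Q1) := by ring
    have e4 : (Mr * A) * (4 * (nAm * nAp)) = 4 * Mr * A * (nAm * nAp) := by ring
    have hMA : 0 < Mr * A := mul_pos hMr0 hA0
    have hk4 : (Mr * A) * (4 * (nAm * nAp)) ≤ (Mr * A) * (4 * Mr * L + A * Q1) := by
      rw [e3, e4]; linarith only [hk, hk1, hk2]
    have hk5 := le_of_mul_le_mul_left hk4 hMA
    linarith only [hk5]
  have hFF : F0 * F1 ≤ E * I ^ 2 := by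
    have hI0 : 0 ≤ Real.exp (ε / 2) * I := by positivity
    calc F0 * F1 ≤ (Real.exp (ε / 2) * I) * (Real.exp (ε / 2) * I) := mul_le_mul hF0le hF1le hF1 hI0
      _ = (Real.exp (ε / 2) * Real.exp (ε / 2)) * I ^ 2 := by ring
      _ = E * I ^ 2 := by rw [← Real.exp_add, show ε / 2 + ε / 2 = ε by ring]
  have hP' : -(E * I ^ 2 * (2 * Mr * L + A * Q1 / 2)) ≤ ReP := by
    have hnn : 0 ≤ nAm * nAp := mul_nonneg hnAm hnAp
    have h1 : F0 * F1 * (nAm * nAp) ≤ E * I ^ 2 * (nAm * nAp) := mul_le_mul_of_nonneg_right hFF hnn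
    have h2 : E * I ^ 2 * (2 * (nAm * nAp)) ≤ E * I ^ 2 * (2 * Mr * L + A * Q1 / 2) :=
      mul_le_mul_of_nonneg_left hpole (by positivity)
    linarith only [hP, h1, h2]
  -- the diagonal: `log(ε⁻¹N/(2I²)) ≥ log Mr + log 40 − log 4`
  have hdiag : Real.log Mr + Real.log 40 - Real.log 4 ≤ Real.log (ε⁻¹ * N / (2 * I ^ 2)) := by
    have hI2pos : 0 < 2 * I ^ 2 := by positivity
    -- `ε⁻¹ N/(2I²) ≥ (40 Mr)/4`
    have hinv : 40 * Mr ≤ ε⁻¹ := by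
      rw [le_inv_comm₀ (by positivity) hε]
      have : ε * (40 * Mr) ≤ 1 := by linarith only [hlam]
      calc ε = ε * (40 * Mr) * (40 * Mr)⁻¹ := by field_simp
        _ ≤ 1 * (40 * Mr)⁻¹ := mul_le_mul_of_nonneg_right this (by positivity)
        _ = (40 * Mr)⁻¹ := one_mul _
    have hq : 40 * Mr / 4 ≤ ε⁻¹ * N / (2 * I ^ 2) := by
      rw [div_le_div_iff₀ (by norm_num) hI2pos]
      have h1 : 40 * Mr * (2 * I ^ 2) ≤ 40 * Mr * (4 * N) :=
        mul_le_mul_of_nonneg_left (by linarith only [hI2]) (by positivity)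
      have h2 : 40 * Mr * (4 * N) ≤ ε⁻¹ * (4 * N) := mul_le_mul_of_nonneg_right hinv (by positivity)
      linarith only [h1, h2]
    have hlog := Real.log_le_log (by positivity) hq
    rw [Real.log_div (by positivity) (by norm_num), Real.log_mul (by norm_num) hMr0.ne'] at hlog
    linarith only [hlog]
  -- `Wd` per unit
  have hWd' : ε⁻¹ * N * (Real.log Mr + Real.log 40 - Real.log 4 - 1) - 21 / (5 * Real.pi) * I ^ 2 ≤ Wd := by
    have h1 : ε⁻¹ * N * (Real.log Mr + Real.log 40 - Real.log 4 - 1) ≤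
        ε⁻¹ * N * (Real.log (ε⁻¹ * N / (2 * I ^ 2)) - 1) :=
      mul_le_mul_of_nonneg_left (by linarith only [hdiag]) (by positivity)
    linarith only [h1, hWd]
  have hpiI : 21 / (5 * Real.pi) * I ^ 2 ≤ 2.8 * N := by
    have h1 : 21 / (5 * Real.pi) ≤ 1.4 := by
      rw [div_le_iff₀ (by positivity)]
      linarith only [hπ3]
    have h2 : 21 / (5 * Real.pi) * I ^ 2 ≤ 1.4 * I ^ 2 := mul_le_mul_of_nonneg_right h1 (sq_nonneg _)
    linarith only [h2, hI2, hN]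
  -- replace `I²` by `2N` in the negative terms
  have hP'' : -(2 * E * N * (2 * Mr * L + A * Q1 / 2)) ≤ ReP := by
    have h0 : 0 ≤ E * (2 * Mr * L + A * Q1 / 2) := by positivity
    have h1 : E * I ^ 2 * (2 * Mr * L + A * Q1 / 2) ≤ E * (2 * N) * (2 * Mr * L + A * Q1 / 2) := by
      have := mul_le_mul_of_nonneg_left hI2 h0
      linarith only [this]
    linarith only [hP', h1]
  have hOff' : -(2 * N * E * κ * A * Q1) ≤ Off := by
    have h0 : 0 ≤ E * κ * A * Q1 := by positivity
    have h1 : I ^ 2 * (E * κ * A * Q1) ≤ 2 * N * (E * κ * A * Q1) := mul_le_mul_of_nonneg_right hI2 h0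
    have e1 : I ^ 2 * E * κ * A * Q1 = I ^ 2 * (E * κ * A * Q1) := by ring
    have e2 : 2 * N * E * κ * A * Q1 = 2 * N * (E * κ * A * Q1) := by ring
    rw [e1] at hOff
    rw [e2]
    linarith only [hOff, h1]
  -- the Helson form
  have hNε : 0 < ε⁻¹ * N := by positivity
  set Y : ℝ := ε⁻¹ * N with hY
  have hYε : Y * ε = N := by rw [hY]; field_simp
  have hHle : Y * H ≤ Y * ((Real.log Mr + 39 / 50) * L) - Y * D := by
    rw [hH, mul_sub]
    have h := mul_le_mul_of_nonneg_left hV hNε.le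
    linarith only [h]
  -- the diagonal times `L`
  have hLWd : L * (Y * (Real.log Mr + Real.log 40 - Real.log 4 - 1)) - L * (2.8 * N) ≤ L * Wd := by
    have hWd'' : Y * (Real.log Mr + Real.log 40 - Real.log 4 - 1) - 2.8 * N ≤ Wd := by
      linarith only [hWd', hpiI]
    have h := mul_le_mul_of_nonneg_left hWd'' hL
    have e : L * (Y * (Real.log Mr + Real.log 40 - Real.log 4 - 1) - 2.8 * N) =
        L * (Y * (Real.log Mr + Real.log 40 - Real.log 4 - 1)) - L * (2.8 * N) := by ring
    rw [e] at h
    exact h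
  -- collect: `ReQ ≥ Y D + c Y L − 4E (N Mr) L − (E + 2Eκ)(N A Q1) − 2.8 N L`
  have hcollect : Y * D + (Real.log 40 - Real.log 4 - 1 - 39 / 50) * (Y * L)
      - 4 * E * ((N * Mr) * L) - (E + 2 * E * κ) * (N * (A * Q1)) - 2.8 * (N * L) ≤ ReQ := by
    have e1 : 2 * E * N * (2 * Mr * L + A * Q1 / 2) = 4 * E * ((N * Mr) * L) + E * (N * (A * Q1)) := by ring
    have e2 : 2 * N * E * κ * A * Q1 = 2 * E * κ * (N * (A * Q1)) := by ring
    have e3 : Y * ((Real.log Mr + 39 / 50) * L) = Real.log Mr * (Y * L) + 39 / 50 * (Y * L) := by ring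
    have e4 : L * (Y * (Real.log Mr + Real.log 40 - Real.log 4 - 1)) =
        Real.log Mr * (Y * L) + (Real.log 40 - Real.log 4 - 1) * (Y * L) := by ring
    have e5 : L * (2.8 * N) = 2.8 * (N * L) := by ring
    have e6 : (E + 2 * E * κ) * (N * (A * Q1)) = E * (N * (A * Q1)) + 2 * E * κ * (N * (A * Q1)) := by ring
    rw [hQ, e6]
    rw [e1] at hP''
    rw [e2] at hOff'
    rw [e3] at hHle
    rw [e4, e5] at hLWd
    linarith only [hP'', hOff', hHle, hLWd]
  -- absolute forms of the small quantities: `N Mr ≤ Y/40`, `N ≤ Y/40`, `N A Q1 ≤ 11 (N Mr) D + 2.265 (N Mr) L`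
  have hNMr : N * Mr ≤ Y / 40 := by
    have h := mul_le_mul_of_nonneg_left hlam hNε.le
    have e : Y * (ε * Mr) = N * Mr := by rw [← hYε]; ring
    rw [e] at h
    linarith only [h]
  have hN40 : N ≤ Y / 40 := by
    have h := mul_le_mul_of_nonneg_left hε40 hNε.le
    rw [hYε] at h
    linarith only [h]
  have hNAQ : N * (A * Q1) ≤ 11 * ((N * Mr) * D) + 2.265 * ((N * Mr) * L) := by
    have hP10 := hPoinc 10 (by norm_num)
    have h1 : A * Q1 ≤ Qp + Mr * L := by rw [hA, add_comm]; exact hQ1le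
    have h2 : A * Q1 ≤ 11 * Mr * D + 2.265 * Mr * L := by
      have e : (1 + 10) * Mr * D + (1 + 1 / 10) * (23 / 20) * Mr * L = 11 * Mr * D + 1.265 * Mr * L := by ring
      rw [e] at hP10
      linarith only [h1, hP10]
    have h3 := mul_le_mul_of_nonneg_left h2 hN.le
    have e2 : N * (11 * Mr * D + 2.265 * Mr * L) = 11 * ((N * Mr) * D) + 2.265 * ((N * Mr) * L) := by ring
    rw [e2] at h3
    exact h3
  -- numeric coefficient bounds
  have hEk : E + 2 * E * κ ≤ 3.197 := by
    have : E * κ ≤ 1.0257 * 1.0583 := mul_le_mul hEle hκle hκpos.le (by norm_num)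
    linarith only [this, hEle]
  have hEk0 : 0 ≤ E + 2 * E * κ := by positivity
  have hYD : 0 ≤ Y * D := mul_nonneg hNε.le hD
  have hYL : 0 ≤ Y * L := mul_nonneg hNε.le hL
  have hNMrD : (N * Mr) * D ≤ Y / 40 * D := mul_le_mul_of_nonneg_right hNMr hD
  have hNMrL : (N * Mr) * L ≤ Y / 40 * L := mul_le_mul_of_nonneg_right hNMr hL
  have hNL : N * L ≤ Y / 40 * L := mul_le_mul_of_nonneg_right hN40 hL
  -- term 1: `4E (N Mr) L ≤ 4 · 1.0257 · (Y/40) L`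
  have hT1 : 4 * E * ((N * Mr) * L) ≤ 4 * 1.0257 * (Y / 40 * L) := by
    have h0 : 0 ≤ (N * Mr) * L := by positivity
    have := mul_le_mul hEle hNMrL h0 (by norm_num)
    linarith only [this]
  -- term 2: `(E + 2Eκ)(N A Q1) ≤ 3.197 (11 (Y/40) D + 2.265 (Y/40) L)`
  have hT2 : (E + 2 * E * κ) * (N * (A * Q1)) ≤ 3.197 * (11 * (Y / 40 * D) + 2.265 * (Y / 40 * L)) := by
    have h0 : 0 ≤ N * (A * Q1) := by positivity
    have h1 : N * (A * Q1) ≤ 11 * (Y / 40 * D) + 2.265 * (Y / 40 * L) := by linarith only [hNAQ, hNMrD, hNMrL]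
    calc (E + 2 * E * κ) * (N * (A * Q1)) ≤ (E + 2 * E * κ) * (11 * (Y / 40 * D) + 2.265 * (Y / 40 * L)) :=
          mul_le_mul_of_nonneg_left h1 hEk0
      _ ≤ 3.197 * (11 * (Y / 40 * D) + 2.265 * (Y / 40 * L)) :=
          mul_le_mul_of_nonneg_right hEk (by positivity)
  -- term 3 is `hNL`; the constant `c = log 40 − log 4 − 1 − 39/50 ≥ 0.5222`
  have hc : (0.5222 : ℝ) * (Y * L) ≤ (Real.log 40 - Real.log 4 - 1 - 39 / 50) * (Y * L) := by
    apply mul_le_mul_of_nonneg_right _ hYL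
    rw [hlog40]
    linarith only [hlog10]
  have eYD : Y / 40 * D = (1 / 40) * (Y * D) := by ring
  have eYL : Y / 40 * L = (1 / 40) * (Y * L) := by ring
  rw [eYD, eYL] at hT2
  rw [eYL] at hT1 hNL
  linarith only [hcollect, hT1, hT2, hNL, hc, hYD, hYL]

end Summit.RiemannHypothesis.RiemannHypothesis.Theorems.WeilCombBohrFejer

end
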